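import Summits.BirchSwinnertonDyer.BirchSwinnertonDyer.Theorems.TeichmullerTwistDescentWeilTypeManinGlue
import Summits.BirchSwinnertonDyer.BirchSwinnertonDyer.Theorems.AdditiveKolyvaginRoadIstarIsogenyInvariance
import Summits.BirchSwinnertonDyer.Rank1Residual.Additive.GordManinConstant
import Summits.BirchSwinnertonDyer.Rank1Residual.Additive.GordIsogenyInvariance
import Summits.BirchSwinnertonDyer.Rank1Residual.Additive.GordKodairaType
import Literature.NumberTheory.EllipticCurves.CuspFormLFunctionLevelConductorProofs
import HarnessLib

/-!
# Route `TeichmullerTwistDescent`, cruxes PSMU (stmt-BirchSwinnertonDyer-22638) and SCMU57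
# (stmt-BirchSwinnertonDyer-22639): REDUCTION TO ON-CURVE CELLS at the `X₀(N)`-optimal curve —
# what print closes, what stays open (repair census, `--supports`)

Cell `pub/bsd-wall` (D-0145 line route-BirchSwinnertonDyer-TeichmullerTwistDescent, DRAFT rev 0),
seat `bsd-line-ttd-p2` (prover 2/2, g0). THEOREMS ONLY (no definition, no named fact, no `sorry`);
nothing is booked, no item is closed, BSD is not proved by this. The two Manin cruxes of the line,

* PSMU `PrincipalSeriesOptimalManinUnit` — `p ≥ 5` additive, `E[p]` irreducible, a `(G)`-ordinary
  member, a member without `Iₙ*` fibre at `p`, `D` a LATTICE-OPTIMAL datum of `W` at ANY level `N`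
  ⟹ `p ∤ c(D)`;
* SCMU57 `SupercuspidalOptimalManinUnitFiveSeven` — `p ∈ {5, 7}`, no `(G)`-ordinary member, the rest
  verbatim ⟹ `p ∤ c(D)`,

are here REDUCED, inside the tree, to statements about ONE curve — the optimal `W` itself, with its
datum at the CONDUCTOR level and its Kodaira type at the place `(p)` — and split into the cells that
print closes and the cells that stay open:

* §1 `principalSeriesOptimalManinUnit_of_cells` — **PSMU ⟸ Edixhoven 1991 Thm. 3 (Kodaira reading,
  tree fact `edixhoven_not_dvd_maninConstant_of_kodairaSymbol_ne`) + Modularity (`exists_isNewformOf`,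
  for level = conductor, Carayol) + TWO OPEN ON-CURVE CELLS**:
  (PS≥11) `p ≥ 11`, `W` optimal at conductor level, additive, `E[p]` irreducible, `(G)`-ordinary,
  `ord_p Δ_min(W) ≤ 4` (Kodaira II/III/IV) ⟹ `p ∤ c` — Edixhoven's exceptional case ("we cannot
  prove that case 1 does not occur", op. cit. §4), the SAME open content as route
  AdditiveKolyvaginRoad's stub S11 / twist-degree step TDS
  (`ManinFrameResidueProperTwistDegree.exists_member_not_dvd_c_iff_twistDegreeStep`);
  (PS57) `p ∈ {5, 7}`, `W` optimal at conductor level, additive, `E[p]` irreducible, `(G)`-ordinary,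
  no `Iₙ*` fibre at `(p)` ⟹ `p ∤ c` — below Edixhoven's `p > 7`; `(G)` forces `e ∣ p − 1`, so these
  are Kodaira III/III* at `5` and II/IV/IV*/II* at `7`.
  The glue is tree theorems only: level `=` conductor (`IsNewformOf.level_eq_conductorNorm_of_exists_isNewformOf`),
  `(G)`-ordinarity and "no `Iₙ*` fibre" are `ℚ`-isogeny invariants read on `W`
  (`Additive.typeGOrd_iff_of_isIsogenous`, `IstarIsogenyInvariance.forall_kodairaSymbolAt_ne_Istar_of_isIsogenous`),
  and at `p ≥ 11` off the types II/III/IV Edixhoven's theorem (`Additive.Addv.not_dvd_maninConstant_of_four_lt`).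
* §2 `cells_of_principalSeriesOptimalManinUnit` — conversely PSMU implies both cells (instantiate at
  `W' = W`), so **PSMU ⟺ (PS≥11) ∧ (PS57) granted Edixhoven + Modularity**: nothing is lost.
* §3 `supercuspidalOptimalManinUnitFiveSeven_of_cell` / `cell_of_supercuspidalOptimalManinUnitFiveSeven`
  — **SCMU57 ⟺ (SC57) granted Modularity**: (SC57) `p ∈ {5, 7}`, `W` optimal at conductor level,
  additive, `E[p]` irreducible, NOT `(G)`-ordinary, no `Iₙ*` fibre at `(p)` ⟹ `p ∤ c` (potentially
  good supersingular: `e ∤ p − 1`, Kodaira II/IV/IV*/II* at `5`, III/III* at `7`). No print covers it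
  (Edixhoven's supersingular remark is inside `p > 7`).

T10 READING (cell TYPING-CHECKLIST): PSMU and SCMU57 as filed carry NO printed antecedent, yet every
proof of PSMU uses Edixhoven's Thm. 3 on the starred types at `p ≥ 11` and Carayol/Modularity for the
any-level binder `N`; so a by-name closer of the filed decls is at best `proof.conditional`. The
repaired signatures these theorems close by `exact` once restated are
`PSMU_R := edixhoven_not_dvd_maninConstant_of_kodairaSymbol_ne → exists_isNewformOf → <PSMU body>` and
`SCMU57_R := exists_isNewformOf → <SCMU57 body>`, with (PS≥11), (PS57), (SC57) as the registered stubs.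
[cite: EdixhovenManin1991, Thm. 3 and §4] [cite: SilvermanATAEC1994, IV Table 4.1]
[cite: CesnaviciusNeururerSaha2023, §1] [cite: BCDTJAMS2001, Thm. A]
-/

set_option autoImplicit false
-- single-conjunct summit: `Summit.BirchSwinnertonDyer.BirchSwinnertonDyer.…` repeats the name by design
set_option linter.dupNamespace false

noncomputable section

open scoped Classical

open WeierstrassCurve IsDedekindDomain Rat.HeightOneSpectrum
  Literature.NumberTheory.EllipticCurves Literature.NumberTheory.EllipticCurves.ModularForms
  Literature.NumberTheory.EllipticCurves.Rank1Residual Literature.NumberTheory.DiophantineGeometry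
  Summit.BirchSwinnertonDyer.Rank1Residual.Additive
open Summit.BirchSwinnertonDyer.BirchSwinnertonDyer.Theses.TeichmullerTwistDescent

namespace Summit.BirchSwinnertonDyer.BirchSwinnertonDyer.Theorems.TeichmullerTwistDescent

/-! ### §0 Bookkeeping at the place `(p)` -/

/-- The place `placeOf p` of `ℤ` has generator `p`. [folklore] -/
theorem natGenerator_placeOf (p : ℕ) [hp : Fact p.Prime] : natGenerator (placeOf p) = p :=
  congrArg Subtype.val ((primesEquiv (R := ℤ)).apply_symm_apply ⟨p, hp.out⟩)

/-- A place of `ℤ` with generator `p` IS `placeOf p`. [folklore] -/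
theorem eq_placeOf_of_natGenerator_eq {p : ℕ} [hp : Fact p.Prime] {v : HeightOneSpectrum ℤ}
    (hv : natGenerator v = p) : v = placeOf p := by
  apply (primesEquiv (R := ℤ)).injective
  rw [placeOf, Equiv.apply_symm_apply]
  exact Subtype.ext hv

/-- "No `Iₙ*` fibre at any place with generator `p`" is "no `Iₙ*` fibre at `placeOf p`". [folklore] -/
theorem forall_ne_Istar_iff_placeOf (W : WeierstrassCurve ℚ) (p : ℕ) [Fact p.Prime] :
    (∀ (v : HeightOneSpectrum ℤ) (n : ℕ), natGenerator v = p → W.kodairaSymbolAt v ≠ .Istar n) ↔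
      ∀ n : ℕ, W.kodairaSymbolAt (placeOf p) ≠ .Istar n := by
  constructor
  · intro h n
    exact h (placeOf p) n (natGenerator_placeOf p)
  · intro h v n hv
    rw [eq_placeOf_of_natGenerator_eq hv]
    exact h n

/-- **The class hypothesis "some globally minimal member has no `Iₙ*` fibre at `p`" read on the
curve** (`p` odd): then `W` itself has no `Iₙ*` fibre at `placeOf p` — a type `Iₙ*` of `W` would
transport to the member (`IstarIsogenyInvariance.forall_kodairaSymbolAt_ne_Istar_of_isIsogenous`,
route-independent). [cite: SilvermanATAEC1994, IV.9.4 Steps 6–7] -/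
theorem forall_ne_Istar_of_member (W : WeierstrassCurve ℚ) [W.IsElliptic] (p : ℕ) [Fact p.Prime]
    (hp2 : p ≠ 2)
    (hI : ∃ (W' : WeierstrassCurve ℚ) (_ : W'.IsElliptic) (_ : W'.IsGloballyMinimal),
      IsIsogenous W W' ∧ ∀ (v : HeightOneSpectrum ℤ) (n : ℕ), natGenerator v = p →
        W'.kodairaSymbolAt v ≠ .Istar n) :
    ∀ n : ℕ, W.kodairaSymbolAt (placeOf p) ≠ .Istar n := by
  obtain ⟨W', hE', _, hiso, hI'⟩ := hI
  haveI := hE'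
  have h := IstarIsogenyInvariance.forall_kodairaSymbolAt_ne_Istar_of_isIsogenous
    hiso.symm_of_charZero hp2 (placeOf p) (natGenerator_placeOf p)
    (fun n => hI' (placeOf p) n (natGenerator_placeOf p))
  exact fun n => h (placeOf p) n (natGenerator_placeOf p)

/-- At an additive `p ≥ 5`, "no `Iₙ*` fibre at `(p)`" puts `ord_p Δ_min` off `6` (indeed off
`{6, 7, …}` except `8, 9, 10`; only `≠ 6`, the `I₀*` value, is recorded).
[cite: SilvermanATAEC1994, IV Table 4.1 (PDF p. 365)] -/
theorem padicValInt_ne_six_of_forall_ne_Istar (W : WeierstrassCurve ℚ) [W.IsElliptic]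
    [W.IsGloballyMinimal] (p : ℕ) [Fact p.Prime] (hp5 : 5 ≤ p) (hadd : Addv W p)
    (hI : ∀ n : ℕ, W.kodairaSymbolAt (placeOf p) ≠ .Istar n) :
    padicValInt p W.minimalDiscriminantInt ≠ 6 := by
  rcases kodairaSymbolAt_placeOf_cases_of_addv W p hp5 hadd with
    ⟨-, hv⟩ | ⟨-, hv⟩ | ⟨-, hv⟩ | ⟨n, hk, -⟩ | ⟨-, hv⟩ | ⟨-, hv⟩ | ⟨-, hv⟩
  all_goals first | omega | exact absurd hk (hI n)

/-- At an additive `p ≥ 5`, `ord_p Δ_min ≤ 4` (types II/III/IV) excludes every `Iₙ*` fibre at `(p)`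
(`Iₙ* ↦ n + 6`). [cite: SilvermanATAEC1994, IV Table 4.1 (PDF p. 365)] -/
theorem forall_ne_Istar_of_padicValInt_le_four (W : WeierstrassCurve ℚ) [W.IsElliptic]
    [W.IsGloballyMinimal] (p : ℕ) [Fact p.Prime] (hp5 : 5 ≤ p) (hadd : Addv W p)
    (hv4 : padicValInt p W.minimalDiscriminantInt ≤ 4) :
    ∀ n : ℕ, W.kodairaSymbolAt (placeOf p) ≠ .Istar n := by
  intro n hk
  rcases kodairaSymbolAt_placeOf_cases_of_addv W p hp5 hadd with
    ⟨hk', -⟩ | ⟨hk', -⟩ | ⟨hk', -⟩ | ⟨m, hk', hv⟩ | ⟨hk', -⟩ | ⟨hk', -⟩ | ⟨hk', -⟩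
  all_goals first | omega | (rw [hk] at hk'; cases hk')

/-! ### §1 PSMU from Edixhoven + Modularity + the two open on-curve cells -/

/-- **PSMU reduced to the optimal curve.** Granted Edixhoven 1991 Thm. 3 in the Kodaira reading
(`hEdxK`) and Modularity (`hnf`, used only for level `=` conductor), the crux
`PrincipalSeriesOptimalManinUnit` follows from two ON-CURVE cells about a globally minimal `W` with a
lattice-optimal datum at its conductor level, additive at `p` with `E[p]` irreducible and
`(G)`-ordinary: (PS≥11) `p ≥ 11` and `ord_p Δ_min(W) ≤ 4` (Kodaira II/III/IV — Edixhoven's open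
exceptional case); (PS57) `p ∈ {5, 7}` and no `Iₙ*` fibre at `(p)`. Proof: the datum's level is the
conductor (Carayol via `hnf`); `(G)`-ordinarity and the absence of `Iₙ*` fibres pass from the given
members to `W` (isogeny invariants); at `p ≥ 11` with `ord_p Δ_min > 4` Edixhoven's theorem applies
to the strong datum `D`, the rest is the two cells.
[cite: EdixhovenManin1991, Thm. 3] [cite: SilvermanATAEC1994, IV Table 4.1] -/
theorem principalSeriesOptimalManinUnit_of_cells
    (hEdxK : edixhoven_not_dvd_maninConstant_of_kodairaSymbol_ne)
    (hnf : exists_isNewformOf)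
    (h11 : ∀ (W : WeierstrassCurve ℚ) [W.IsElliptic] [W.IsGloballyMinimal] (p : ℕ) [Fact p.Prime]
      [NeZero (W.conductorNorm ℤ)] (D : ModularParametrizationData W (W.conductorNorm ℤ)),
      11 ≤ p → Addv W p → Irr W p → TypeGOrd W p → padicValInt p W.minimalDiscriminantInt ≤ 4 →
      (∀ z ∈ D.L.lattice, ∃ w ∈ periodLattice D.f, z = D.c * w) → ¬ (p : ℤ) ∣ D.c)
    (h57 : ∀ (W : WeierstrassCurve ℚ) [W.IsElliptic] [W.IsGloballyMinimal] (p : ℕ) [Fact p.Prime]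
      [NeZero (W.conductorNorm ℤ)] (D : ModularParametrizationData W (W.conductorNorm ℤ)),
      (p = 5 ∨ p = 7) → Addv W p → Irr W p → TypeGOrd W p →
      (∀ n : ℕ, W.kodairaSymbolAt (placeOf p) ≠ .Istar n) →
      (∀ z ∈ D.L.lattice, ∃ w ∈ periodLattice D.f, z = D.c * w) → ¬ (p : ℤ) ∣ D.c) :
    PrincipalSeriesOptimalManinUnit := by
  intro W _ _ p _ N _ D hp5 hadd hirr hG hI hlat
  have hp : p.Prime := Fact.out
  have hp2 : p ≠ 2 := by omega
  -- the level of a datum is the conductor (Carayol, from Modularity)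
  have hN : N = W.conductorNorm ℤ :=
    IsNewformOf.level_eq_conductorNorm_of_exists_isNewformOf hnf D.isNewformOf
  subst hN
  -- `(G)`-ordinarity read on `W`
  obtain ⟨W', hE', hM', hiso', hG'⟩ := hG
  haveI := hE'
  haveI := hM'
  have hGW : TypeGOrd W p := (typeGOrd_iff_of_isIsogenous hp2 hadd hiso').mpr hG'
  -- no `Iₙ*` fibre, read on `W`
  have hIW : ∀ n : ℕ, W.kodairaSymbolAt (placeOf p) ≠ .Istar n := forall_ne_Istar_of_member W p hp2 hI
  rcases Nat.lt_or_ge p 11 with h11p | h11p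
  · exact h57 W p D
      (WeilTypeManinGlue.eq_five_or_eq_seven_of_prime_of_five_le_of_lt_eleven hp hp5 h11p)
      hadd hirr hGW hIW hlat
  · by_cases hv4 : padicValInt p W.minimalDiscriminantInt ≤ 4
    · exact h11 W p D h11p hadd hirr hGW hv4 hlat
    · -- starred types at `p ≥ 11`: Edixhoven 1991 Thm. 3
      exact Addv.not_dvd_maninConstant_of_four_lt W p hEdxK D hlat (by omega) hadd (by omega)

/-! ### §2 Conversely: PSMU gives both cells -/

/-- **PSMU ⟹ (PS≥11) and (PS57)** (instantiate the class hypotheses at `W' = W`; at `p ≥ 11` the bound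
`ord_p Δ_min ≤ 4` itself excludes `Iₙ*` fibres). So, granted Edixhoven + Modularity, PSMU is
EQUIVALENT to the conjunction of the two on-curve cells. [cite: SilvermanATAEC1994, IV Table 4.1] -/
theorem cells_of_principalSeriesOptimalManinUnit (hPS : PrincipalSeriesOptimalManinUnit) :
    (∀ (W : WeierstrassCurve ℚ) [W.IsElliptic] [W.IsGloballyMinimal] (p : ℕ) [Fact p.Prime]
      [NeZero (W.conductorNorm ℤ)] (D : ModularParametrizationData W (W.conductorNorm ℤ)),
      11 ≤ p → Addv W p → Irr W p → TypeGOrd W p → padicValInt p W.minimalDiscriminantInt ≤ 4 →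
      (∀ z ∈ D.L.lattice, ∃ w ∈ periodLattice D.f, z = D.c * w) → ¬ (p : ℤ) ∣ D.c) ∧
    (∀ (W : WeierstrassCurve ℚ) [W.IsElliptic] [W.IsGloballyMinimal] (p : ℕ) [Fact p.Prime]
      [NeZero (W.conductorNorm ℤ)] (D : ModularParametrizationData W (W.conductorNorm ℤ)),
      (p = 5 ∨ p = 7) → Addv W p → Irr W p → TypeGOrd W p →
      (∀ n : ℕ, W.kodairaSymbolAt (placeOf p) ≠ .Istar n) →
      (∀ z ∈ D.L.lattice, ∃ w ∈ periodLattice D.f, z = D.c * w) → ¬ (p : ℤ) ∣ D.c) := by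
  refine ⟨fun W _ _ p _ _ D h11p hadd hirr hG hv4 hlat => ?_,
    fun W _ _ p _ _ D hp57 hadd hirr hG hI hlat => ?_⟩
  · have hp5 : 5 ≤ p := by omega
    exact hPS W p (W.conductorNorm ℤ) D hp5 hadd hirr
      ⟨W, ‹_›, ‹_›, isIsogenous_self W, hG⟩
      ⟨W, ‹_›, ‹_›, isIsogenous_self W, (forall_ne_Istar_iff_placeOf W p).mpr
        (forall_ne_Istar_of_padicValInt_le_four W p hp5 hadd hv4)⟩ hlat
  · have hp5 : 5 ≤ p := by rcases hp57 with rfl | rfl <;> omega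
    exact hPS W p (W.conductorNorm ℤ) D hp5 hadd hirr
      ⟨W, ‹_›, ‹_›, isIsogenous_self W, hG⟩
      ⟨W, ‹_›, ‹_›, isIsogenous_self W, (forall_ne_Istar_iff_placeOf W p).mpr hI⟩ hlat

/-! ### §3 SCMU57 ⟺ the supercuspidal on-curve cell (SC57), granted Modularity -/

/-- **SCMU57 reduced to the optimal curve.** Granted Modularity (`hnf`, level `=` conductor only), the
crux `SupercuspidalOptimalManinUnitFiveSeven` follows from the ON-CURVE cell (SC57): `p ∈ {5, 7}`,
`W` globally minimal with a lattice-optimal datum at its conductor level, additive at `p`, `E[p]`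
irreducible, NOT `(G)`-ordinary, no `Iₙ*` fibre at `(p)` ⟹ `p ∤ c`. (The class hypothesis "no member
is `(G)`-ordinary" is read at `W` itself; "no `Iₙ*` member" transports to `W`.) No printed theorem
covers (SC57). [cite: EdixhovenManin1991, Thm. 3 (p > 7 only)] -/
theorem supercuspidalOptimalManinUnitFiveSeven_of_cell (hnf : exists_isNewformOf)
    (hSC : ∀ (W : WeierstrassCurve ℚ) [W.IsElliptic] [W.IsGloballyMinimal] (p : ℕ) [Fact p.Prime]
      [NeZero (W.conductorNorm ℤ)] (D : ModularParametrizationData W (W.conductorNorm ℤ)),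
      (p = 5 ∨ p = 7) → Addv W p → Irr W p → ¬ TypeGOrd W p →
      (∀ n : ℕ, W.kodairaSymbolAt (placeOf p) ≠ .Istar n) →
      (∀ z ∈ D.L.lattice, ∃ w ∈ periodLattice D.f, z = D.c * w) → ¬ (p : ℤ) ∣ D.c) :
    SupercuspidalOptimalManinUnitFiveSeven := by
  intro W _ _ p _ N _ D hp57 hadd hirr hnoG hI hlat
  have hp2 : p ≠ 2 := by rcases hp57 with rfl | rfl <;> omega
  have hN : N = W.conductorNorm ℤ :=
    IsNewformOf.level_eq_conductorNorm_of_exists_isNewformOf hnf D.isNewformOf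
  subst hN
  have hGW : ¬ TypeGOrd W p := hnoG W (isIsogenous_self W)
  have hIW : ∀ n : ℕ, W.kodairaSymbolAt (placeOf p) ≠ .Istar n := forall_ne_Istar_of_member W p hp2 hI
  exact hSC W p D hp57 hadd hirr hGW hIW hlat

/-- **SCMU57 ⟹ (SC57)** (the class hypothesis "no member is `(G)`-ordinary" follows from `¬ TypeGOrd W p`
by isogeny invariance of `(G)`-ordinarity on the additive locus, `Additive.typeGOrd_iff_of_isIsogenous`;
the `Iₙ*`-free member is `W`). So SCMU57 ⟺ (SC57) granted Modularity. [folklore] -/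
theorem cell_of_supercuspidalOptimalManinUnitFiveSeven (hSC : SupercuspidalOptimalManinUnitFiveSeven) :
    ∀ (W : WeierstrassCurve ℚ) [W.IsElliptic] [W.IsGloballyMinimal] (p : ℕ) [Fact p.Prime]
      [NeZero (W.conductorNorm ℤ)] (D : ModularParametrizationData W (W.conductorNorm ℤ)),
      (p = 5 ∨ p = 7) → Addv W p → Irr W p → ¬ TypeGOrd W p →
      (∀ n : ℕ, W.kodairaSymbolAt (placeOf p) ≠ .Istar n) →
      (∀ z ∈ D.L.lattice, ∃ w ∈ periodLattice D.f, z = D.c * w) → ¬ (p : ℤ) ∣ D.c := by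
  intro W _ _ p _ _ D hp57 hadd hirr hG hI hlat
  have hp2 : p ≠ 2 := by rcases hp57 with rfl | rfl <;> omega
  refine hSC W p (W.conductorNorm ℤ) D hp57 hadd hirr (fun W' _ _ hiso hG' => ?_)
    ⟨W, ‹_›, ‹_›, isIsogenous_self W, (forall_ne_Istar_iff_placeOf W p).mpr hI⟩ hlat
  exact hG ((typeGOrd_iff_of_isIsogenous hp2 hadd hiso).mpr hG')

end Summit.BirchSwinnertonDyer.BirchSwinnertonDyer.Theorems.TeichmullerTwistDescent

end
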